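import Literature.AlgebraicGeometry.Resolution.GeneralizedStabilityRankOneVTReduced
import Mathlib.RingTheory.Norm.Transitivity
import Mathlib.GroupTheory.PGroup
import HarnessLib

/-!
# Generalized stability for `K(x)^h` without the Lemma of Ostrowski, I: steps of prime degree (Kuhlmann 2010, §5)

Topic: `Literature/AlgebraicGeometry/Resolution` (valued function fields). First of three files
re-assembling the named fact `Kuhlmann2010StabilityHenselizedRationalValueTranscendental`
(`GeneralizedStabilityRankOneVT.lean` = F.-V. Kuhlmann, *Elimination of ramification I: The
generalized stability theorem*, Trans. AMS 362 (2010) 5697–5727 = arXiv:1003.5678, §5, proof of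
(R4), pp. 18–20: "the henselized rational function field `K(x)^h` of rank one with a
value-transcendental generator over an algebraically closed `K` is a defectless field") from the
SINGLE named fact `Kuhlmann2010HenselizedRationalImmediateExt` (the italicized statement of §5,
p. 19), i.e. WITHOUT the Lemma of Ostrowski (`Kuhlmann2010OstrowskiLemma`, §2.3 (9)) on which the
assembly of `GeneralizedStabilityRankOneVTProofs.lean` / `…VTReduced.lean` rests ("the
henselization is henselian", "the henselization is immediate" and Lemma 5.5 being PROVED:
`HenselizationHenselian.lean`, `HenselizationImmediateProofs.lean`,
`GeneralizedStabilityLemma55VT.lean`, `GeneralizedStabilityRankOneVTReduced.lean`).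

The printed proof (pp. 19–20) uses Ostrowski's lemma `[L:K] = (vL:vK)[Lv:Kv] p^ν` to dispose of
the sub-extensions of degree prime to `p` and to turn a step of degree `p` with `ν ≥ 1` into an
immediate one. Over the base fields of the induction — `M = K(x')^h` of rank one, `x'`
value-transcendental over the algebraically closed `K` (§2.5, (4.2)) — both uses can be replaced
by two elementary observations, which is what this file supplies:

* `[Nv : Mv] = 1` for EVERY finite `N ≥ M`: `Mv = K(x')v = Kv` (Lemma 2.2: `K(x')^h|K(x')` is
  immediate; Lemma 2.5: `K(x')v = Kv`) is algebraically closed with `K`, and `Nv|Mv` is finite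
  (fundamental inequality).
* if every value `v(y)`, `y ∈ N^×`, has a `q^k`-th power in `vM` (`q` prime), then
  `(vN : vM)` is a power of `q` (the finite group `vN/vM` is a `q`-group); for `[N : M] = q`
  this leaves `(vN : vM) ∈ {1, q}`, and `(vN : vM) = 1 = [Nv : Mv]` would make `N|M` immediate,
  hence trivial by the italicized statement of §5 — so `(vN : vM) = q = [N : M]`: **steps of prime
  degree `q` over `K(x')^h`-fields are defectless** as soon as the values of `N` are `q`-power
  torsion modulo `vM`. This is the case for a Galois step of degree `q` (the norm
  `N(y) = ∏ σ(y)` lies in `M` and `v(σ(y)) = v(y)`, every `σ` preserving `V ∩ N` — the extension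
  of `V ∩ M` to `N` is unique over the henselian `M` — and having finite order), and for a
  radical (purely inseparable) step, `y^{q^k} ∈ M`.

The next files (`GeneralizedStabilityRankOneVTSylow.lean`, `…VTImmediate.lean`) run the
induction of p. 20 through the Sylow subgroups for ALL primes `q` and assemble the named fact.

## Content (everything PROVED)

* `valuation_map_le_iff_of_forall_mem_iff`, `valuation_map_eq_of_forall_mem_iff` — an
  automorphism of finite order of a valued field `(L, W)` with `σ(W) = W` preserves the
  valuation: `v(σ(y)) = v(y)`.
* `IsHenselizedRationalVT.isHenselianField'`, `IsHenselizedRationalVT.of_relFinite'`,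
  `IsHenselizedRationalVT.le`, `IsHenselizedRationalVT.resField_le` — the class of base fields
  `K(x')^h` (`IsHenselizedRationalVT`, `GeneralizedStabilityRankOneVTGalois.lean`) with the proved
  facts plugged in (`Kuhlmann2010Lemma55ValueTranscendental.of_immediateExt'`,
  `GeneralizedStabilityRankOneVTReduced.lean`): henselian, stable under finite extensions
  (Lemma 5.5, from the italicized statement), `K ≤ M`, `Mv ≤ Kv`.
* `relInertiaDegree_eq_one_of_resField_le` — `f(N|M) = 1` for `N|M` finite when `Mv ⊆ Kv`, `K`
  algebraically closed, `K ≤ M`.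
* `exists_relRamificationIndex_eq_pow` — `e(N|M) = q^j` when the values of `N^×` are `q`-power
  torsion modulo `vM`.
* `exists_valuation_pow_eq_of_isGalois` — for `N|M` finite Galois over a henselian `M`:
  `v(y)^{[N:M]} ∈ vM` (`y ∈ N`).
* `IsHenselizedRationalVT.isDefectlessPair_of_prime`, `…_of_isGalois_prime`,
  `…_of_pow_mem_prime` — steps of prime degree over `K(x')^h`-fields are defectless (from
  `Kuhlmann2010HenselizedRationalImmediateExt` alone).

## Sources

* F.-V. Kuhlmann, *Elimination of ramification I: The generalized stability theorem*, Trans.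
  Amer. Math. Soc. 362 (2010) 5697–5727 = arXiv:1003.5678: §1 (fundamental inequality), §1.1
  (henselian fields: uniqueness of the extension), Lemma 2.2, Lemma 2.5, §2.5, §5 (proof of
  (R4), pp. 18–20: the italicized statement, Lemma 5.5, the induction).

## Rendering notes

* The replacement of Ostrowski's lemma by the two observations above is a routine variant of the
  printed argument special to the base fields `K(x')^h` over an algebraically closed `K` (where
  `f = 1` automatically); it is tagged `[folklore]` where it deviates from print.
* As in `GeneralizedStabilityRankOneVTPairs.lean`, pairs `M ≤ N` of subfields of `Ω` carry the
  inclusion algebra `letI : Algebra M N := (Subfield.inclusion h).toAlgebra`.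
-/

noncomputable section

open IsLocalRing

namespace Literature.AlgebraicGeometry.Resolution

universe u

/-! ### Automorphisms of finite order preserving the valuation ring preserve the valuation -/

section Invariance

variable {F L : Type*} [Field F] [Field L] [Algebra F L] (W : ValuationSubring L)

/-- If `σ(W) = W` for an automorphism `σ` of the valued field `(L, W)`, then `σ` preserves the
order of values: `v(σ b) ≤ v(σ a) ↔ v(b) ≤ v(a)`. [folklore] -/
theorem valuation_map_le_iff_of_forall_mem_iff (σ : L ≃ₐ[F] L) (hσ : ∀ u : L, σ u ∈ W ↔ u ∈ W)
    (a b : L) : W.valuation (σ b) ≤ W.valuation (σ a) ↔ W.valuation b ≤ W.valuation a := by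
  by_cases ha : a = 0
  · subst ha
    rw [map_zero, map_zero, le_zero_iff, le_zero_iff, map_eq_zero, map_eq_zero, map_eq_zero]
  · have hσa : σ a ≠ 0 := (EmbeddingLike.map_ne_zero_iff).mpr ha
    have hva : 0 < W.valuation a := zero_lt_iff.mpr ((map_ne_zero _).mpr ha)
    have hvσa : 0 < W.valuation (σ a) := zero_lt_iff.mpr ((map_ne_zero _).mpr hσa)
    rw [← div_le_one₀ hva, ← div_le_one₀ hvσa, ← map_div₀, ← map_div₀, ← map_div₀,
      W.valuation_le_one_iff, W.valuation_le_one_iff, hσ]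

/-- Strict version of `valuation_map_le_iff_of_forall_mem_iff`. [folklore] -/
theorem valuation_map_lt_iff_of_forall_mem_iff (σ : L ≃ₐ[F] L) (hσ : ∀ u : L, σ u ∈ W ↔ u ∈ W)
    (a b : L) : W.valuation (σ a) < W.valuation (σ b) ↔ W.valuation a < W.valuation b := by
  rw [← not_le, ← not_le, valuation_map_le_iff_of_forall_mem_iff W σ hσ]

/-- **An automorphism of finite order mapping the valuation ring onto itself preserves the
valuation**: if `σ(W) = W` and `σ` has finite order, then `v(σ y) = v(y)` for all `y` (were
`v(σ y) < v(y)`, then `v(σ^{k+1} y) < v(y)` for all `k`, contradicting `σ^n = 1`). [folklore] -/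
theorem valuation_map_eq_of_forall_mem_iff (σ : L ≃ₐ[F] L) (hσ : ∀ u : L, σ u ∈ W ↔ u ∈ W)
    (hfin : IsOfFinOrder σ) (y : L) : W.valuation (σ y) = W.valuation y := by
  have hlt : ∀ a b : L, W.valuation a < W.valuation b →
      W.valuation (σ a) < W.valuation (σ b) := fun a b h =>
    (valuation_map_lt_iff_of_forall_mem_iff W σ hσ a b).mpr h
  obtain ⟨n, hn, hσn⟩ := hfin.exists_pow_eq_one
  rcases lt_trichotomy (W.valuation (σ y)) (W.valuation y) with h | h | h
  · exfalso
    have key : ∀ k : ℕ, W.valuation ((σ ^ (k + 1)) y) < W.valuation y := by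
      intro k
      induction k with
      | zero => simpa using h
      | succ k ih =>
        have h2 := hlt _ _ ih
        rw [pow_succ', AlgEquiv.mul_apply]
        exact h2.trans h
    have hk := key (n - 1)
    rw [Nat.sub_add_cancel hn, hσn, AlgEquiv.one_apply] at hk
    exact lt_irrefl _ hk
  · exact h
  · exfalso
    have key : ∀ k : ℕ, W.valuation y < W.valuation ((σ ^ (k + 1)) y) := by
      intro k
      induction k with
      | zero => simpa using h
      | succ k ih =>
        have h2 := hlt _ _ ih
        rw [pow_succ', AlgEquiv.mul_apply]
        exact h.trans h2
    have hk := key (n - 1)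
    rw [Nat.sub_add_cancel hn, hσn, AlgEquiv.one_apply] at hk
    exact lt_irrefl _ hk

end Invariance

/-! ### The base fields `K(x')^h` with the proved facts plugged in -/

section Wrappers

variable {Ω : Type u} [Field Ω] [IsAlgClosed Ω] {V : ValuationSubring Ω} {K : Subfield Ω}

/-- `K(x')^h`-fields are henselian (Lemma 2.3, `Kuhlmann2010HenselizationIsHenselian_holds`).
[cite: Kuhlmann2010, Lemma 2.3] -/
theorem IsHenselizedRationalVT.isHenselianField' {M : Subfield Ω}
    (hMcl : IsHenselizedRationalVT V K M) : IsHenselianField M (V.comap (algebraMap M Ω)) := by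
  obtain ⟨x, -, -, rfl⟩ := hMcl
  exact isHenselianField_henselizedAdjoin Kuhlmann2010HenselizationIsHenselian_holds K x

/-- **Finite extensions of `K(x)^h`-fields are `K(x')^h`-fields** (Lemma 5.5), from the
italicized statement of §5 alone. [cite: Kuhlmann2010, Lemma 5.5] -/
theorem IsHenselizedRationalVT.of_relFinite' (hM : Kuhlmann2010HenselizedRationalImmediateExt.{u})
    (hK : IsAlgClosed K) {M N : Subfield Ω} (hMcl : IsHenselizedRationalVT V K M) (h : M ≤ N)
    (hfin : RelFinite M N h) : IsHenselizedRationalVT V K N := by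
  obtain ⟨x, hx, hr, rfl⟩ := hMcl
  obtain ⟨x', -, hx', hN⟩ :=
    exists_eq_henselizedAdjoin_of_relFinite Kuhlmann2010HenselizationIsHenselian_holds
      (Kuhlmann2010Lemma55ValueTranscendental.of_immediateExt' hM) hK hx hr h hfin
  refine ⟨x', hx', ?_, hN⟩
  rw [← hN]
  exact hr.of_algebraic V h (forall_isAlgebraic_of_relFinite h hfin)

omit [IsAlgClosed Ω] in
/-- `K ≤ M` for a `K(x')^h`-field `M`. [folklore] -/
theorem IsHenselizedRationalVT.le {M : Subfield Ω} (hMcl : IsHenselizedRationalVT V K M) : K ≤ M := by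
  obtain ⟨x, -, -, rfl⟩ := hMcl
  exact le_henselizedAdjoin V K x

/-- **`K(x')^h v = Kv`** (as an inclusion of residue fields inside that of `V`): Lemma 2.2
(`K(x')^h | K(x')` is immediate, `Kuhlmann2010HenselizationImmediate_holds`) and Lemma 2.5
(`K(x')v = Kv`, `resField_adjoin_le`). [cite: Kuhlmann2010, Lemma 2.2 and Lemma 2.5] -/
theorem IsHenselizedRationalVT.resField_le {M : Subfield Ω} (hMcl : IsHenselizedRationalVT V K M) :
    resField V M ≤ resField V K := by
  obtain ⟨x, hx, -, rfl⟩ := hMcl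
  exact (Kuhlmann2010HenselizationImmediate_holds Ω V _).2.trans (resField_adjoin_le hx)

end Wrappers

/-! ### `f = 1` over fields with algebraically closed residue field -/

section InertiaOne

variable {Ω : Type u} [Field Ω] {V : ValuationSubring Ω} {K : Subfield Ω}

/-- **`[Nv : Mv] = 1` for `N|M` finite when `Mv ⊆ Kv` with `K ≤ M` algebraically closed**
(so `Mv = Kv` is algebraically closed, Kuhlmann 2010, proof of Lemma 5.5: "Since `K(x)‾ = K̄` is
algebraically closed and `F̄|K(x)‾` is finite, we have `F̄ = K(x)‾`"): every residue of `V ∩ N`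
is algebraic over the image of `Mv` (fundamental inequality: `Nv|Mv` is finite), hence — read in
the residue field of `V`, over the algebraically closed `Kv` — it is the residue of an element of
`K ≤ M`. PROVED. [cite: Kuhlmann2010, Lemma 5.5 (proof, Case I)] -/
theorem relInertiaDegree_eq_one_of_resField_le (hK : IsAlgClosed K) {M N : Subfield Ω}
    (hKM : K ≤ M) (hres : resField V M ≤ resField V K) (h : M ≤ N) (hfin : RelFinite M N h) :
    relInertiaDegree V M N h = 1 := by
  classical
  letI : Algebra M N := (Subfield.inclusion h).toAlgebra
  haveI : FiniteDimensional M N := hfin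
  haveI : IsAlgClosed K := hK
  haveI : IsAlgClosed (resField V K) := isAlgClosed_resField_of_isAlgClosed V K
  set W : ValuationSubring N := V.comap (algebraMap N Ω) with hWdef
  haveI hfinres : Module.Finite (residueSubfield M W) (ResidueField W) :=
    (ramificationIndex_mul_inertiaDegree_le_finrank M W).2.1
  -- the embedding `residueSubfield M W → Kv` compatible with `Nv → Ωv`
  have hmemK : ∀ s : residueSubfield M W,
      residueFieldHom N V (s : ResidueField W) ∈ resField V K := by
    intro s
    obtain ⟨c, hc, hcs⟩ := (mem_residueSubfield_iff M W _).mp s.2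
    rw [← hcs, residueFieldHom_residue_comap]
    exact hres (residue_mem_resField V _ c.2)
  let f : residueSubfield M W →+* resField V K :=
    ((residueFieldHom N V).comp (residueSubfield M W).subtype).codRestrict (resField V K) hmemK
  have hcomp : (algebraMap (resField V K) (ResidueField V)).comp f =
      (residueFieldHom N V).comp (algebraMap (residueSubfield M W) (ResidueField W)) :=
    RingHom.ext fun _ => rfl
  -- every residue of `W` is the residue of an element of `M`
  have htop : residueSubfield M W = ⊤ := by
    refine eq_top_iff.mpr fun r _ => ?_
    have hr : IsAlgebraic (residueSubfield M W) r := Algebra.IsAlgebraic.isAlgebraic r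
    have hr' : IsAlgebraic (resField V K) (residueFieldHom N V r) :=
      hr.ringHom_of_comp_eq f (residueFieldHom N V) f.injective hcomp
    have hdeg := IsAlgClosed.degree_eq_one_of_irreducible (resField V K)
      (minpoly.irreducible hr'.isIntegral)
    obtain ⟨r₀, hr₀⟩ := minpoly.mem_range_of_degree_eq_one (resField V K) _ hdeg
    have hmemM : residueFieldHom N V r ∈ resField V M := by
      rw [← hr₀]
      exact resField_mono V hKM r₀.2
    obtain ⟨a, haM, ha⟩ := (mem_resField_iff V M _).mp hmemM
    have haW : algebraMap M N ⟨(a : Ω), haM⟩ ∈ W := a.2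
    refine (mem_residueSubfield_iff M W r).mpr ⟨⟨(a : Ω), haM⟩, haW, ?_⟩
    apply (residueFieldHom N V).injective
    rw [residueFieldHom_residue_comap, ← ha]
    exact congrArg (residue V) (Subtype.ext rfl)
  -- `f = [Nv : Mv] = [Nv : Nv] = 1`
  change inertiaDegree M W = 1
  unfold inertiaDegree
  rw [htop]
  have hfr := Algebra.finrank_eq_of_equiv_equiv
    (Subfield.topEquiv : (⊤ : Subfield (ResidueField W)) ≃+* ResidueField W)
    (RingEquiv.refl (ResidueField W)) (by ext; rfl)
  rw [hfr, Module.finrank_self]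

end InertiaOne

/-! ### `e` is a power of `q` when the values are `q`-power torsion modulo `vM` -/

section RamificationPow

variable {Ω : Type u} [Field Ω] {V : ValuationSubring Ω}

/-- **`(vN : vM)` is a power of the prime `q`** if every value `v(y)`, `y ∈ N^×`, has a
`q^k`-th power in `vM`: the finite group `vN/vM` is then a `q`-group. PROVED. [folklore] -/
theorem exists_relRamificationIndex_eq_pow {M N : Subfield Ω} (h : M ≤ N) (hfin : RelFinite M N h)
    {q : ℕ} (hq : q.Prime)
    (hpow : ∀ y ∈ N, y ≠ 0 → ∃ k : ℕ, ∃ c ∈ M, V.valuation y ^ q ^ k = V.valuation c) :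
    ∃ j : ℕ, relRamificationIndex V M N h = q ^ j := by
  classical
  letI : Algebra M N := (Subfield.inclusion h).toAlgebra
  haveI : FiniteDimensional M N := hfin
  haveI : Fact q.Prime := ⟨hq⟩
  set W : ValuationSubring N := V.comap (algebraMap N Ω) with hWdef
  haveI : (valueSubgroup M W).FiniteIndex := (ramificationIndex_mul_inertiaDegree_le_finrank M W).1
  -- the quotient `vN/vM` is a `q`-group
  have hP : IsPGroup q ((ValuationSubring.ValueGroup W)ˣ ⧸ valueSubgroup M W) := by
    intro g
    obtain ⟨γ, rfl⟩ := QuotientGroup.mk_surjective g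
    obtain ⟨y, hy⟩ := W.valuation_surjective (γ : ValuationSubring.ValueGroup W)
    have hy0 : (y : Ω) ≠ 0 := fun h0 => γ.ne_zero (by
      rw [← hy, map_eq_zero]
      exact Subtype.ext h0)
    obtain ⟨k, c, hcM, hk⟩ := hpow y y.2 hy0
    have hc0 : (⟨c, hcM⟩ : M) ≠ 0 := by
      intro hc0
      have hc : c = 0 := congrArg Subtype.val hc0
      rw [hc, map_zero, pow_eq_zero_iff (pow_ne_zero k hq.ne_zero), map_eq_zero] at hk
      exact hy0 hk
    refine ⟨k, ?_⟩
    rw [← QuotientGroup.mk_pow, QuotientGroup.eq_one_iff]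
    refine (mem_valueSubgroup_iff M W _).mpr ⟨⟨c, hcM⟩, hc0, ?_⟩
    apply valueGroupHom_injective N V
    rw [Units.val_pow_eq_pow_val, ← hy, map_pow, valueGroupHom_valuation, valueGroupHom_valuation]
    exact hk
  obtain ⟨j, hj⟩ := IsPGroup.iff_card.mp hP
  exact ⟨j, hj⟩

/-- Radical extensions supply the hypothesis of `exists_relRamificationIndex_eq_pow`: if
`y^{q^k} ∈ M` then `v(y)^{q^k} ∈ vM`. [folklore] -/
theorem exists_valuation_pow_eq_of_pow_mem {M N : Subfield Ω} {q : ℕ}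
    (hpow : ∀ y ∈ N, ∃ k : ℕ, y ^ q ^ k ∈ M) {y : Ω} (hy : y ∈ N) :
    ∃ k : ℕ, ∃ c ∈ M, V.valuation y ^ q ^ k = V.valuation c := by
  obtain ⟨k, hk⟩ := hpow y hy
  exact ⟨k, y ^ q ^ k, hk, by rw [map_pow]⟩

/-- **`v(y)^{[N:M]} ∈ vM` for `N|M` finite Galois over a henselian `M`**: the norm
`N(y) = ∏_σ σ(y)` lies in `M`, and `v(σ(y)) = v(y)` for every `σ ∈ Gal(N|M)` since `σ` has finite
order and maps `V ∩ N` — the unique extension of `V ∩ M` to `N` (§1.1) — onto itself. PROVED.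
[cite: Kuhlmann2010, Section 1.1] -/
theorem exists_valuation_pow_eq_of_isGalois {M N : Subfield Ω} (h : M ≤ N)
    (hMh : IsHenselianField M (V.comap (algebraMap M Ω))) (hfin : RelFinite M N h)
    (hgal : letI : Algebra M N := (Subfield.inclusion h).toAlgebra; IsGalois M N)
    {y : Ω} (hy : y ∈ N) :
    ∃ c ∈ M, V.valuation y ^ relFinrank M N h = V.valuation c := by
  classical
  letI : Algebra M N := (Subfield.inclusion h).toAlgebra
  haveI : IsScalarTower M N Ω := IsScalarTower.of_algebraMap_eq fun _ => rfl
  haveI : FiniteDimensional M N := hfin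
  haveI : IsGalois M N := hgal
  set W : ValuationSubring N := V.comap (algebraMap N Ω) with hWdef
  have halg := forall_isAlgebraic_of_relFinite h hfin
  -- every automorphism maps `W` onto itself, hence preserves the valuation
  have hσW : ∀ (σ : N ≃ₐ[M] N) (u : N), σ u ∈ W ↔ u ∈ W := by
    intro σ u
    have hWσ : W.comap (σ : N →+* N) = W := by
      refine eq_comap_of_isHenselianField h hMh halg _ ?_
      ext c
      simp only [ValuationSubring.mem_comap, RingHom.coe_coe, AlgEquiv.commutes]
      exact Iff.rfl
    have := SetLike.ext_iff.mp hWσ u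
    rw [ValuationSubring.mem_comap] at this
    exact this
  have hinv : ∀ (σ : N ≃ₐ[M] N) (u : N), W.valuation (σ u) = W.valuation u := fun σ u =>
    valuation_map_eq_of_forall_mem_iff W σ (hσW σ) (isOfFinOrder_of_finite σ) u
  -- the norm of `y`
  set c₀ : M := Algebra.norm M (⟨y, hy⟩ : N) with hc₀def
  refine ⟨(c₀ : Ω), c₀.2, ?_⟩
  have hprod : W.valuation (algebraMap M N c₀) =
      W.valuation (⟨y, hy⟩ : N) ^ Module.finrank M N := by
    rw [hc₀def, Algebra.norm_eq_prod_automorphisms M (⟨y, hy⟩ : N), map_prod]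
    simp_rw [hinv]
    rw [Finset.prod_const, Finset.card_univ, ← Nat.card_eq_fintype_card,
      IsGalois.card_aut_eq_finrank]
  have := congrArg (valueGroupHom N V) hprod
  rw [map_pow, valueGroupHom_valuation, valueGroupHom_valuation] at this
  exact this.symm

end RamificationPow

/-! ### Steps of prime degree over `K(x')^h`-fields are defectless -/

section PrimeSteps

variable {Ω : Type u} [Field Ω] [IsAlgClosed Ω] {V : ValuationSubring Ω} {K : Subfield Ω}

/-- **A step of prime degree `q` over a `K(x')^h`-field whose values are `q`-power torsion
modulo `vM` is defectless**, from the italicized statement of §5 alone: `f = 1`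
(`relInertiaDegree_eq_one_of_resField_le`), `e = q^j ≤ q` (`exists_relRamificationIndex_eq_pow`,
fundamental inequality), and `e = 1` would make `N|M` immediate, hence `N = M`
(`Kuhlmann2010HenselizedRationalImmediateExt`) — absurd; so `e f = q = [N : M]`. PROVED.
[cite: Kuhlmann2010, Section 5, proof of Thm. 1.1 (pp. 19–20)] -/
theorem IsHenselizedRationalVT.isDefectlessPair_of_prime
    (hM : Kuhlmann2010HenselizedRationalImmediateExt.{u}) (hK : IsAlgClosed K)
    {M N : Subfield Ω} (hMcl : IsHenselizedRationalVT V K M) (h : M ≤ N) (hfin : RelFinite M N h)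
    {q : ℕ} (hq : q.Prime) (hdeg : relFinrank M N h = q)
    (hpow : ∀ y ∈ N, y ≠ 0 → ∃ k : ℕ, ∃ c ∈ M, V.valuation y ^ q ^ k = V.valuation c) :
    IsDefectlessPair V M N h := by
  have hf : relInertiaDegree V M N h = 1 :=
    relInertiaDegree_eq_one_of_resField_le hK hMcl.le hMcl.resField_le h hfin
  obtain ⟨j, hj⟩ := exists_relRamificationIndex_eq_pow h hfin hq hpow
  have hle := relRamificationIndex_mul_relInertiaDegree_le (V := V) h hfin
  rw [hf, mul_one, hdeg, hj] at hle
  have hj1 : j ≤ 1 := by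
    by_contra hj1
    push Not at hj1
    have h2 : q ^ 2 ≤ q ^ j := Nat.pow_le_pow_right hq.pos hj1
    have h3 : q < q ^ 2 := by
      rw [pow_two]
      exact lt_mul_self hq.one_lt
    omega
  unfold IsDefectlessPair
  rw [hf, mul_one, hdeg, hj]
  interval_cases j
  · -- `e = 1`: the step is immediate, hence trivial — absurd
    exfalso
    rw [pow_zero] at hj
    have himm : IsImmediateOver V M N := isImmediateOver_of_rel_eq_one h hj hf
    obtain ⟨x, hx, hr, rfl⟩ := hMcl
    have hEq : N = henselizedAdjoin V K x :=
      hM Ω V K hK x hx hr N h (forall_isAlgebraic_of_relFinite h hfin) himm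
    subst hEq
    have h1 := relFinrank_self_eq_one h hfin h
    rw [hdeg] at h1
    exact hq.one_lt.ne' h1
  · rw [pow_one]

/-- **Galois steps of prime degree over `K(x')^h`-fields are defectless** (the norm supplies
`v(y)^q ∈ vM`). PROVED. [cite: Kuhlmann2010, Section 5, proof of Thm. 1.1 (pp. 19–20)] -/
theorem IsHenselizedRationalVT.isDefectlessPair_of_isGalois_prime
    (hM : Kuhlmann2010HenselizedRationalImmediateExt.{u}) (hK : IsAlgClosed K)
    {M N : Subfield Ω} (hMcl : IsHenselizedRationalVT V K M) (h : M ≤ N) (hfin : RelFinite M N h)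
    (hgal : letI : Algebra M N := (Subfield.inclusion h).toAlgebra; IsGalois M N)
    {q : ℕ} (hq : q.Prime) (hdeg : relFinrank M N h = q) : IsDefectlessPair V M N h :=
  hMcl.isDefectlessPair_of_prime hM hK h hfin hq hdeg fun y hy _ => by
    obtain ⟨c, hc, hyc⟩ :=
      exists_valuation_pow_eq_of_isGalois h hMcl.isHenselianField' hfin hgal hy
    exact ⟨1, c, hc, by rw [pow_one, ← hdeg]; exact hyc⟩

/-- **Radical steps of prime degree over `K(x')^h`-fields are defectless** (`y^{q^k} ∈ M`
supplies `v(y)^{q^k} ∈ vM`; the purely inseparable steps of Prop. 3.1). PROVED.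
[cite: Kuhlmann2010, Section 5, proof of Thm. 1.1 (pp. 19–20)] -/
theorem IsHenselizedRationalVT.isDefectlessPair_of_pow_mem_prime
    (hM : Kuhlmann2010HenselizedRationalImmediateExt.{u}) (hK : IsAlgClosed K)
    {M N : Subfield Ω} (hMcl : IsHenselizedRationalVT V K M) (h : M ≤ N) (hfin : RelFinite M N h)
    {q : ℕ} (hq : q.Prime) (hdeg : relFinrank M N h = q)
    (hpow : ∀ y ∈ N, ∃ k : ℕ, y ^ q ^ k ∈ M) : IsDefectlessPair V M N h :=
  hMcl.isDefectlessPair_of_prime hM hK h hfin hq hdeg fun _ hy _ =>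
    exists_valuation_pow_eq_of_pow_mem hpow hy

end PrimeSteps

end Literature.AlgebraicGeometry.Resolution
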